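import Literature.MathematicalPhysics.QuantumLattice.BilayerSplittingIdentities

/-!
# The `t–t′–t″` square-lattice band at the high-symmetry points: exact identities

Elementary EXACT evaluations of the one-band dispersion
`ε(k) = −2t(cos k₀ + cos k₁) − 4t′ cos k₀ cos k₁ − 2t″(cos 2k₀ + cos 2k₁)`
(the tree's `squareDispersion₃ t t' t''`, [AndersenEtAl1995, §7 Eq. (16)]) at the points
`Γ = (0,0)`, `X = (π,0)`, `Y = (0,π)`, `M = (π,π)` and the nodal point `N = (π/2, π/2)` of the
square Brillouin zone, and their consequences — the statements that the downfolding tables use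
when they quote "`W = 8t`", "`t′` moves the antinodal saddle", or "the electron-doped side is the
particle–hole image with `t′ ↦ −t′`":

* `squareDispersion₃_gamma/_X/_Y/_M/_nodal`: `ε(Γ) = −4t − 4t′ − 4t″`, `ε(X) = ε(Y) = 4t′ − 4t″`,
  `ε(M) = 4t − 4t′ − 4t″`, `ε(N) = 4t″`.
* `squareDispersion₃_M_sub_gamma`: `ε(M) − ε(Γ) = 8t` for EVERY `t′, t″` — so any interval
  `[a, b]` containing the band has `b − a ≥ 8|t|` (`eight_mul_abs_le_of_band_subset`), while
  `|ε(k)| ≤ 4(|t| + |t′| + |t″|)` everywhere (`abs_squareDispersion₃_le`); together: the bandwidth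
  `W` of a `t–t′–t″` band satisfies `8|t| ≤ W ≤ 8(|t| + |t′| + |t″|)`, with `W = 8t` whenever the
  extrema sit at `Γ` and `M`.
* `squareDispersion₃_X_sub_gamma = 4t + 8t′`, `squareDispersion₃_M_sub_X = 4t − 8t′`,
  `squareDispersion₃_X_sub_nodal = 4t′ − 8t″`: where the saddle `X` sits relative to `Γ`, `M` and
  the node is decided by `t′` (and `t″`) alone.
* `squareDispersion₃_shift_pi`: the staggered shift `k ↦ k + (π,π)` maps the band to MINUS the band
  with `t′ ↦ −t′`, `t″ ↦ −t″` (and the same `t`):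
  `ε_{t,t′,t″}(k + (π,π)) = −ε_{t,−t′,−t″}(k)` — the one-body face of the bipartite particle–hole
  (Shiba) transformation [EsslerEtAl2005, §2.2.4 eqs. (2.59)–(2.61)], under which a nearest-
  neighbour bond keeps its hopping and a same-sublattice (`t′`, `t″`) bond changes sign; it is the
  reason an electron-doped `t–t′–t″` band at filling `n` is read as a hole-doped band at `2 − n`
  with `(t′, t″) ↦ (−t′, −t″)`.
* `squareDispersion₃_swap`, `squareDispersion₃_neg_fst`: the `D₄` invariances `(k₀,k₁) ↦ (k₁,k₀)`
  and `k₀ ↦ −k₀`.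

Everything is a proved theorem (trigonometric evaluation); no named facts, no axioms beyond
Mathlib's, no `sorry`.  Not here: the location of the GLOBAL extrema for large `|t′|` (when the
maximum leaves `M` for the zone edge), densities of states, van Hove fillings.

References: O. K. Andersen, A. I. Liechtenstein, O. Jepsen, F. Paulsen, J. Phys. Chem. Solids 56
(1995) 1573, §7 Eq. (16) (the `t–t′–t″` one-band form); F. H. L. Essler, H. Frahm, F. Göhmann,
A. Klümper, V. E. Korepin, *The One-Dimensional Hubbard Model* (CUP 2005), §2.2.4 (particle–hole
transformation with the bipartite sign).  AI-produced formalisation (H21, cell hubbard-downfold,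
seat lit-2, 2026-08-27).
-/

namespace Literature.MathematicalPhysics.QuantumLattice

open Real

noncomputable section

/-- The momentum with Cartesian coordinates `(a, b)`. [cite: AndersenEtAl1995, §7 Eq. (16)] -/
def mom (a b : ℝ) : Momentum := WithLp.toLp 2 ![a, b]

/-- First coordinate of `mom a b`. [cite: AndersenEtAl1995, §7 Eq. (16)] -/
@[simp] theorem mom_apply_zero (a b : ℝ) : mom a b 0 = a := by
  simp [mom]

/-- Second coordinate of `mom a b`. [cite: AndersenEtAl1995, §7 Eq. (16)] -/
@[simp] theorem mom_apply_one (a b : ℝ) : mom a b 1 = b := by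
  simp [mom]

/-! ## Values at the high-symmetry points -/

/-- `ε(Γ) = ε(0,0) = −4t − 4t′ − 4t″`. [cite: AndersenEtAl1995, §7 Eq. (16)] -/
theorem squareDispersion₃_gamma (t t' t'' : ℝ) :
    squareDispersion₃ t t' t'' (mom 0 0) = -4 * t - 4 * t' - 4 * t'' := by
  rw [squareDispersion₃_def]
  simp only [mom_apply_zero, mom_apply_one, mul_zero, cos_zero]
  ring

/-- `ε(X) = ε(π,0) = 4t′ − 4t″`. [cite: AndersenEtAl1995, §7 Eq. (16)] -/
theorem squareDispersion₃_X (t t' t'' : ℝ) :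
    squareDispersion₃ t t' t'' (mom π 0) = 4 * t' - 4 * t'' := by
  rw [squareDispersion₃_def]
  simp only [mom_apply_zero, mom_apply_one, mul_zero, cos_zero, cos_pi]
  rw [show (2 : ℝ) * π = 2 * π from rfl, cos_two_pi]
  ring

/-- `ε(Y) = ε(0,π) = 4t′ − 4t″`. [cite: AndersenEtAl1995, §7 Eq. (16)] -/
theorem squareDispersion₃_Y (t t' t'' : ℝ) :
    squareDispersion₃ t t' t'' (mom 0 π) = 4 * t' - 4 * t'' := by
  rw [squareDispersion₃_def]
  simp only [mom_apply_zero, mom_apply_one, mul_zero, cos_zero, cos_pi, cos_two_pi]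
  ring

/-- `ε(M) = ε(π,π) = 4t − 4t′ − 4t″`. [cite: AndersenEtAl1995, §7 Eq. (16)] -/
theorem squareDispersion₃_M (t t' t'' : ℝ) :
    squareDispersion₃ t t' t'' (mom π π) = 4 * t - 4 * t' - 4 * t'' := by
  rw [squareDispersion₃_def]
  simp only [mom_apply_zero, mom_apply_one, cos_pi, cos_two_pi]
  ring

/-- `ε(N) = ε(π/2, π/2) = 4t″` (the nodal point sees only the third-neighbour term).
[cite: AndersenEtAl1995, §7 Eq. (16)] -/
theorem squareDispersion₃_nodal (t t' t'' : ℝ) :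
    squareDispersion₃ t t' t'' (mom (π / 2) (π / 2)) = 4 * t'' := by
  rw [squareDispersion₃_def]
  simp only [mom_apply_zero, mom_apply_one, cos_pi_div_two]
  rw [show (2 : ℝ) * (π / 2) = π by ring, cos_pi]
  ring

/-! ## Differences between high-symmetry points: what `t`, `t′`, `t″` each control -/

/-- **`ε(M) − ε(Γ) = 8t`, independently of `t′` and `t″`.** [cite: AndersenEtAl1995, §7 Eq. (16)] -/
theorem squareDispersion₃_M_sub_gamma (t t' t'' : ℝ) :
    squareDispersion₃ t t' t'' (mom π π) - squareDispersion₃ t t' t'' (mom 0 0) = 8 * t := by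
  rw [squareDispersion₃_M, squareDispersion₃_gamma]; ring

/-- `ε(X) − ε(Γ) = 4t + 8t′`. [cite: AndersenEtAl1995, §7 Eq. (16)] -/
theorem squareDispersion₃_X_sub_gamma (t t' t'' : ℝ) :
    squareDispersion₃ t t' t'' (mom π 0) - squareDispersion₃ t t' t'' (mom 0 0) = 4 * t + 8 * t' := by
  rw [squareDispersion₃_X, squareDispersion₃_gamma]; ring

/-- `ε(M) − ε(X) = 4t − 8t′`. [cite: AndersenEtAl1995, §7 Eq. (16)] -/
theorem squareDispersion₃_M_sub_X (t t' t'' : ℝ) :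
    squareDispersion₃ t t' t'' (mom π π) - squareDispersion₃ t t' t'' (mom π 0) = 4 * t - 8 * t' := by
  rw [squareDispersion₃_M, squareDispersion₃_X]; ring

/-- `ε(X) − ε(N) = 4t′ − 8t″`: the antinodal saddle relative to the nodal energy is set by `t′`
and `t″` only. [cite: AndersenEtAl1995, §7 Eq. (16)] -/
theorem squareDispersion₃_X_sub_nodal (t t' t'' : ℝ) :
    squareDispersion₃ t t' t'' (mom π 0) - squareDispersion₃ t t' t'' (mom (π / 2) (π / 2))
      = 4 * t' - 8 * t'' := by
  rw [squareDispersion₃_X, squareDispersion₃_nodal]; ring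

/-- `X` lies (weakly) between `Γ` and `M` in energy iff `|2t′| ≤ t`; first half:
`ε(Γ) ≤ ε(X) ↔ −2t′ ≤ t`. [cite: AndersenEtAl1995, §7 Eq. (16)] -/
theorem squareDispersion₃_gamma_le_X_iff (t t' t'' : ℝ) :
    squareDispersion₃ t t' t'' (mom 0 0) ≤ squareDispersion₃ t t' t'' (mom π 0) ↔ -2 * t' ≤ t := by
  rw [squareDispersion₃_X, squareDispersion₃_gamma]
  constructor <;> intro h <;> linarith

/-- Second half: `ε(X) ≤ ε(M) ↔ 2t′ ≤ t`. [cite: AndersenEtAl1995, §7 Eq. (16)] -/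
theorem squareDispersion₃_X_le_M_iff (t t' t'' : ℝ) :
    squareDispersion₃ t t' t'' (mom π 0) ≤ squareDispersion₃ t t' t'' (mom π π) ↔ 2 * t' ≤ t := by
  rw [squareDispersion₃_X, squareDispersion₃_M]
  constructor <;> intro h <;> linarith

/-! ## Bandwidth bounds -/

/-- Uniform bound: `|ε(k)| ≤ 4(|t| + |t′| + |t″|)`. [cite: AndersenEtAl1995, §7 Eq. (16)] -/
theorem abs_squareDispersion₃_le (t t' t'' : ℝ) (k : Momentum) :
    |squareDispersion₃ t t' t'' k| ≤ 4 * (|t| + |t'| + |t''|) := by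
  rw [squareDispersion₃_def]
  have h0 := abs_cos_le_one (k 0)
  have h1 := abs_cos_le_one (k 1)
  have h2 := abs_cos_le_one (2 * k 0)
  have h3 := abs_cos_le_one (2 * k 1)
  have e1 : |(-2) * t * (cos (k 0) + cos (k 1))| ≤ 4 * |t| := by
    rw [abs_mul, abs_mul]
    have : |cos (k 0) + cos (k 1)| ≤ 2 := (abs_add_le _ _).trans (by linarith)
    calc |(-2 : ℝ)| * |t| * |cos (k 0) + cos (k 1)| ≤ 2 * |t| * 2 := by
          rw [abs_neg, abs_two]; gcongr
      _ = 4 * |t| := by ring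
  have e2 : |4 * t' * cos (k 0) * cos (k 1)| ≤ 4 * |t'| := by
    rw [abs_mul, abs_mul, abs_mul, abs_of_pos (by norm_num : (0 : ℝ) < 4)]
    calc 4 * |t'| * |cos (k 0)| * |cos (k 1)| ≤ 4 * |t'| * 1 * 1 := by gcongr
      _ = 4 * |t'| := by ring
  have e3 : |2 * t'' * (cos (2 * k 0) + cos (2 * k 1))| ≤ 4 * |t''| := by
    rw [abs_mul, abs_mul, abs_two]
    have : |cos (2 * k 0) + cos (2 * k 1)| ≤ 2 := (abs_add_le _ _).trans (by linarith)
    calc 2 * |t''| * |cos (2 * k 0) + cos (2 * k 1)| ≤ 2 * |t''| * 2 := by gcongr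
      _ = 4 * |t''| := by ring
  calc |(-2) * t * (cos (k 0) + cos (k 1)) - 4 * t' * cos (k 0) * cos (k 1)
          - 2 * t'' * (cos (2 * k 0) + cos (2 * k 1))|
        ≤ |(-2) * t * (cos (k 0) + cos (k 1)) - 4 * t' * cos (k 0) * cos (k 1)|
          + |2 * t'' * (cos (2 * k 0) + cos (2 * k 1))| := abs_sub _ _
    _ ≤ (|(-2) * t * (cos (k 0) + cos (k 1))| + |4 * t' * cos (k 0) * cos (k 1)|)
          + |2 * t'' * (cos (2 * k 0) + cos (2 * k 1))| := by gcongr; exact abs_sub _ _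
    _ ≤ (4 * |t| + 4 * |t'|) + 4 * |t''| := by gcongr
    _ = 4 * (|t| + |t'| + |t''|) := by ring

/-- **Any interval containing the band has length at least `8|t|`** (from the values at `Γ`
and `M`): the bandwidth of a `t–t′–t″` band is `≥ 8|t|` whatever `t′, t″` are.
[cite: AndersenEtAl1995, §7 Eq. (16)] -/
theorem eight_mul_abs_le_of_band_subset (t t' t'' a b : ℝ)
    (h : ∀ k : Momentum, a ≤ squareDispersion₃ t t' t'' k ∧ squareDispersion₃ t t' t'' k ≤ b) :
    8 * |t| ≤ b - a := by
  have hM := h (mom π π)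
  have hG := h (mom 0 0)
  rw [squareDispersion₃_M] at hM
  rw [squareDispersion₃_gamma] at hG
  rcases le_or_gt 0 t with ht | ht
  · rw [abs_of_nonneg ht]; linarith [hM.2, hG.1]
  · rw [abs_of_neg ht]; linarith [hM.1, hG.2]

/-- Conversely the band lies in an interval of length `8(|t| + |t′| + |t″|)`.
[cite: AndersenEtAl1995, §7 Eq. (16)] -/
theorem squareDispersion₃_mem_Icc (t t' t'' : ℝ) (k : Momentum) :
    squareDispersion₃ t t' t'' k ∈ Set.Icc (-(4 * (|t| + |t'| + |t''|))) (4 * (|t| + |t'| + |t''|)) :=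
  abs_le.mp (abs_squareDispersion₃_le t t' t'' k)

/-! ## The staggered shift `k ↦ k + (π, π)` (particle–hole image) and the `D₄` invariances -/

/-- **Particle–hole image at the band level**: `ε_{t,t′,t″}(k + (π,π)) = −ε_{t,−t′,−t″}(k)` — the
nearest-neighbour harmonic changes sign under the staggered shift while the same-sublattice
harmonics (`t′`, `t″`) do not, exactly as in the bipartite particle–hole transformation.
[cite: EsslerEtAl2005, §2.2.4 eqs. (2.59)–(2.61)] -/
theorem squareDispersion₃_shift_pi (t t' t'' : ℝ) (k : Momentum) :
    squareDispersion₃ t t' t'' (mom (k 0 + π) (k 1 + π))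
      = -squareDispersion₃ t (-t') (-t'') k := by
  rw [squareDispersion₃_def, squareDispersion₃_def]
  simp only [mom_apply_zero, mom_apply_one, cos_add_pi]
  have h0 : cos (2 * (k 0 + π)) = cos (2 * k 0) := by
    rw [mul_add, show (2 : ℝ) * π = 2 * π from rfl, cos_add_two_pi]
  have h1 : cos (2 * (k 1 + π)) = cos (2 * k 1) := by
    rw [mul_add, cos_add_two_pi]
  rw [h0, h1]
  ring

/-- The same statement read backwards: the `(t, −t′, −t″)` band is minus the shifted
`(t, t′, t″)` band. [cite: EsslerEtAl2005, §2.2.4 eqs. (2.59)–(2.61)] -/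
theorem squareDispersion₃_neg_params (t t' t'' : ℝ) (k : Momentum) :
    squareDispersion₃ t (-t') (-t'') k = -squareDispersion₃ t t' t'' (mom (k 0 + π) (k 1 + π)) := by
  rw [squareDispersion₃_shift_pi]; ring

/-- `D₄`: swapping the two momentum components leaves the band invariant.
[cite: AndersenEtAl1995, §7 Eq. (16)] -/
theorem squareDispersion₃_swap (t t' t'' : ℝ) (k : Momentum) :
    squareDispersion₃ t t' t'' (mom (k 1) (k 0)) = squareDispersion₃ t t' t'' k := by
  rw [squareDispersion₃_def, squareDispersion₃_def]
  simp only [mom_apply_zero, mom_apply_one]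
  ring

/-- `D₄`: reversing one momentum component leaves the band invariant.
[cite: AndersenEtAl1995, §7 Eq. (16)] -/
theorem squareDispersion₃_neg_fst (t t' t'' : ℝ) (k : Momentum) :
    squareDispersion₃ t t' t'' (mom (-k 0) (k 1)) = squareDispersion₃ t t' t'' k := by
  rw [squareDispersion₃_def, squareDispersion₃_def]
  simp only [mom_apply_zero, mom_apply_one, cos_neg, mul_neg]

/-- With `t′ = t″ = 0` the band is odd under the staggered shift (nearest-neighbour particle–hole
symmetry): `ε_t(k + (π,π)) = −ε_t(k)`. [cite: EsslerEtAl2005, §2.2.4 eqs. (2.59)–(2.61)] -/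
theorem squareDispersion₃_shift_pi_nn (t : ℝ) (k : Momentum) :
    squareDispersion₃ t 0 0 (mom (k 0 + π) (k 1 + π)) = -squareDispersion₃ t 0 0 k := by
  simpa using squareDispersion₃_shift_pi t 0 0 k

end

end Literature.MathematicalPhysics.QuantumLattice
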